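import Summits.Ventures.HodgeRepro2.T5SU11SphericalStrict

/-!
# Derivatives of the spherical functions of `SU(1,1)` in the Cartan parameter:
`t ↦ φ_λ(a_t)` is twice differentiable, with derivatives given by differentiation under Laplace's
integral

For `B(t, φ) = cosh 2t − sinh 2t cos φ` (Laplace's integrand base, `T5SU11SphericalBounds`) the
spherical function is `sph λ (a_t) = (2π)⁻¹ ∫_{-π}^{π} B(t, φ)^{-λ/2} dφ`. Differentiation under the
interval integral for a jointly continuous family `(x, t) ↦ F x t` with jointly continuous partial
derivative `(x, t) ↦ F' x t` (`hasDerivAt_intervalIntegral_of_continuous`: a bound on the compact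
`[x₀ - 1, x₀ + 1] × [a, b]` feeds `intervalIntegral.hasDerivAt_integral_of_dominated_loc_of_deriv_le`)
applied to `F t φ = B^{-λ/2}` (`∂_t B = 2 sinh 2t − 2 cosh 2t cos φ`, `hasDerivAt_laplace_base`;
`∂_t B^μ = B_t · μ · B^{μ-1}`, `hasDerivAt_laplace_rpow`) gives **the first derivative**
`∂_t sph λ (a_t) = (2π)⁻¹ ∫ B_t · (-λ/2) · B^{-λ/2-1} dφ` (`hasDerivAt_sph_hyp`), and applied once more
(`∂_t B_t = 4 cosh 2t − 4 sinh 2t cos φ = 4B`, `hasDerivAt_laplace_base_deriv`;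
`hasDerivAt_laplace_rpow_deriv`) **the second derivative** of Laplace's integral
(`hasDerivAt_integral_laplace`, `hasDerivAt_integral_laplace_deriv`), so `t ↦ sph λ (a_t)` is twice
differentiable in the sense of iterated `HasDerivAt` (`differentiable_sph_hyp`, `deriv_sph_hyp`); its
derivative vanishes at `t = 0` (`deriv_sph_hyp_zero`: the integrand reduces to `λ cos φ`), as the evenness
of row 238 predicts.
These are the inputs of the radial differential equation of the next file. Nothing is claimed about (N).

Blind lane: Mathlib + the HodgeRepro2 prefix only; no sorry; axioms ⊆ {propext, Classical.choice,
Quot.sound}.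
-/

namespace Summit.Ventures.HodgeRepro2.T5SU11SphericalDeriv

open MeasureTheory Metric Set Filter Topology Complex intervalIntegral
open T5SU11Unimodular T5SU11Fibration T5SU11Cartan T5SU11OneParameter T5SU11CartanProjection
  T5HaarCircle T5BergmanCoefficient T5SU11SphericalFunction T5SU11SphericalTwo
  T5SU11SphericalSymmetry T5SU11SphericalBounds T5SU11SphericalContinuous
  T5SU11SphericalAsymptotic T5SU11SphericalLp T5SU11SphericalCfun T5SU11SphericalLpSharp
  T5SU11SphericalXiLog T5SU11SphericalCfunLimit T5SU11SphericalStrict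
open scoped Real

/-! ### Differentiation under the interval integral for jointly continuous families -/

/-- **Differentiation under the interval integral**: if `(x, t) ↦ F x t` and `(x, t) ↦ F' x t` are
continuous on `ℝ × ℝ` and `F' x t` is the derivative of `x ↦ F x t` for every `t`, then
`x ↦ ∫ t in a..b, F x t` has derivative `∫ t in a..b, F' x₀ t` at `x₀`. -/
theorem hasDerivAt_intervalIntegral_of_continuous (F F' : ℝ → ℝ → ℝ) {a b : ℝ}
    (hF : Continuous fun p : ℝ × ℝ => F p.1 p.2) (hF' : Continuous fun p : ℝ × ℝ => F' p.1 p.2)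
    (hd : ∀ x t, HasDerivAt (fun x => F x t) (F' x t) x) (x₀ : ℝ) :
    HasDerivAt (fun x => ∫ t in a..b, F x t) (∫ t in a..b, F' x₀ t) x₀ := by
  obtain ⟨C, hC⟩ := (isCompact_Icc.prod isCompact_uIcc).exists_bound_of_continuousOn
    (hF'.continuousOn (s := Icc (x₀ - 1) (x₀ + 1) ×ˢ uIcc a b))
  have hFx : ∀ x, Continuous fun t => F x t := fun x =>
    hF.comp (continuous_const.prodMk continuous_id)
  have hF'x : ∀ x, Continuous fun t => F' x t := fun x =>
    hF'.comp (continuous_const.prodMk continuous_id)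
  refine (intervalIntegral.hasDerivAt_integral_of_dominated_loc_of_deriv_le (μ := volume)
    (s := ball x₀ 1)
    (bound := fun _ => C) (ball_mem_nhds x₀ one_pos) ?_ ?_ ?_ ?_ ?_ ?_).2
  · exact Filter.Eventually.of_forall fun x => (hFx x).aestronglyMeasurable
  · exact (hFx x₀).intervalIntegrable _ _
  · exact (hF'x x₀).aestronglyMeasurable
  · refine Filter.Eventually.of_forall fun t ht x hx => hC (x, t) ⟨?_, uIoc_subset_uIcc ht⟩
    rw [mem_ball, Real.dist_eq, abs_lt] at hx
    exact ⟨by linarith [hx.1], by linarith [hx.2]⟩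
  · exact intervalIntegrable_const
  · exact Filter.Eventually.of_forall fun t _ x _ => hd x t

/-! ### Laplace's base `B(t, φ) = cosh 2t − sinh 2t cos φ` and its `t`-derivatives -/

/-- `∂_t (cosh 2t − sinh 2t cos φ) = 2 sinh 2t − 2 cosh 2t cos φ`. -/
lemma hasDerivAt_laplace_base (t φ : ℝ) :
    HasDerivAt (fun t => Real.cosh (2 * t) - Real.sinh (2 * t) * Real.cos φ)
      (2 * Real.sinh (2 * t) - 2 * Real.cosh (2 * t) * Real.cos φ) t := by
  have h2 : HasDerivAt (fun t : ℝ => 2 * t) 2 t := by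
    simpa using (hasDerivAt_id' (x := t)).const_mul (2 : ℝ)
  exact (h2.cosh.sub (h2.sinh.mul_const (Real.cos φ))).congr_deriv (by ring)

/-- `∂_t (2 sinh 2t − 2 cosh 2t cos φ) = 4 cosh 2t − 4 sinh 2t cos φ` (`= 4 B`). -/
lemma hasDerivAt_laplace_base_deriv (t φ : ℝ) :
    HasDerivAt (fun t => 2 * Real.sinh (2 * t) - 2 * Real.cosh (2 * t) * Real.cos φ)
      (4 * Real.cosh (2 * t) - 4 * Real.sinh (2 * t) * Real.cos φ) t := by
  have h2 : HasDerivAt (fun t : ℝ => 2 * t) 2 t := by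
    simpa using (hasDerivAt_id' (x := t)).const_mul (2 : ℝ)
  exact ((h2.sinh.const_mul 2).sub ((h2.cosh.const_mul 2).mul_const (Real.cos φ))).congr_deriv
    (by ring)

/-- `∂_t B^μ = B_t · μ · B^{μ-1}`. -/
lemma hasDerivAt_laplace_rpow (μ t φ : ℝ) :
    HasDerivAt (fun t => (Real.cosh (2 * t) - Real.sinh (2 * t) * Real.cos φ) ^ μ)
      ((2 * Real.sinh (2 * t) - 2 * Real.cosh (2 * t) * Real.cos φ) * μ *
        (Real.cosh (2 * t) - Real.sinh (2 * t) * Real.cos φ) ^ (μ - 1)) t :=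
  (hasDerivAt_laplace_base t φ).rpow_const (Or.inl (laplace_base_pos t φ).ne')

/-- `∂_t [B_t · μ · B^{μ-1}] = B_tt · μ · B^{μ-1} + (B_t · μ) · (B_t · (μ-1) · B^{μ-2})`. -/
lemma hasDerivAt_laplace_rpow_deriv (μ t φ : ℝ) :
    HasDerivAt (fun t => (2 * Real.sinh (2 * t) - 2 * Real.cosh (2 * t) * Real.cos φ) * μ *
        (Real.cosh (2 * t) - Real.sinh (2 * t) * Real.cos φ) ^ (μ - 1))
      ((4 * Real.cosh (2 * t) - 4 * Real.sinh (2 * t) * Real.cos φ) * μ *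
          (Real.cosh (2 * t) - Real.sinh (2 * t) * Real.cos φ) ^ (μ - 1) +
        (2 * Real.sinh (2 * t) - 2 * Real.cosh (2 * t) * Real.cos φ) * μ *
          ((2 * Real.sinh (2 * t) - 2 * Real.cosh (2 * t) * Real.cos φ) * (μ - 1) *
            (Real.cosh (2 * t) - Real.sinh (2 * t) * Real.cos φ) ^ (μ - 1 - 1))) t :=
  ((hasDerivAt_laplace_base_deriv t φ).mul_const μ).mul (hasDerivAt_laplace_rpow (μ - 1) t φ)

/-! ### Joint continuity in `(t, φ)` -/

/-- `(t, φ) ↦ B(t, φ)` is continuous. -/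
lemma continuous_laplace_base :
    Continuous fun p : ℝ × ℝ => Real.cosh (2 * p.1) - Real.sinh (2 * p.1) * Real.cos p.2 := by
  fun_prop

/-- `(t, φ) ↦ B_t(t, φ)` is continuous. -/
lemma continuous_laplace_base_deriv :
    Continuous fun p : ℝ × ℝ => 2 * Real.sinh (2 * p.1) - 2 * Real.cosh (2 * p.1) * Real.cos p.2 := by
  fun_prop

/-- `(t, φ) ↦ B_tt(t, φ)` is continuous. -/
lemma continuous_laplace_base_deriv2 :
    Continuous fun p : ℝ × ℝ => 4 * Real.cosh (2 * p.1) - 4 * Real.sinh (2 * p.1) * Real.cos p.2 := by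
  fun_prop

/-- `(t, φ) ↦ B(t, φ)^μ` is continuous. -/
lemma continuous_laplace_rpow (μ : ℝ) :
    Continuous fun p : ℝ × ℝ => (Real.cosh (2 * p.1) - Real.sinh (2 * p.1) * Real.cos p.2) ^ μ :=
  continuous_laplace_base.rpow_const fun p => Or.inl (laplace_base_pos p.1 p.2).ne'

/-- `(t, φ) ↦ B_t · μ · B^{μ-1}` is continuous. -/
lemma continuous_laplace_rpow_deriv (μ : ℝ) :
    Continuous fun p : ℝ × ℝ =>
      (2 * Real.sinh (2 * p.1) - 2 * Real.cosh (2 * p.1) * Real.cos p.2) * μ *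
        (Real.cosh (2 * p.1) - Real.sinh (2 * p.1) * Real.cos p.2) ^ (μ - 1) :=
  (continuous_laplace_base_deriv.mul continuous_const).mul (continuous_laplace_rpow (μ - 1))

/-- `(t, φ) ↦ B_tt · μ · B^{μ-1} + (B_t · μ) · (B_t · (μ-1) · B^{μ-2})` is continuous. -/
lemma continuous_laplace_rpow_deriv2 (μ : ℝ) :
    Continuous fun p : ℝ × ℝ =>
      (4 * Real.cosh (2 * p.1) - 4 * Real.sinh (2 * p.1) * Real.cos p.2) * μ *
          (Real.cosh (2 * p.1) - Real.sinh (2 * p.1) * Real.cos p.2) ^ (μ - 1) +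
        (2 * Real.sinh (2 * p.1) - 2 * Real.cosh (2 * p.1) * Real.cos p.2) * μ *
          ((2 * Real.sinh (2 * p.1) - 2 * Real.cosh (2 * p.1) * Real.cos p.2) * (μ - 1) *
            (Real.cosh (2 * p.1) - Real.sinh (2 * p.1) * Real.cos p.2) ^ (μ - 1 - 1)) :=
  ((continuous_laplace_base_deriv2.mul continuous_const).mul (continuous_laplace_rpow (μ - 1))).add
    ((continuous_laplace_base_deriv.mul continuous_const).mul
      ((continuous_laplace_base_deriv.mul continuous_const).mul (continuous_laplace_rpow (μ - 1 - 1))))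

/-! ### The derivatives of Laplace's integral -/

/-- **The first derivative of Laplace's integral**:
`∂_t ∫_{-π}^{π} B^μ dφ = ∫_{-π}^{π} B_t · μ · B^{μ-1} dφ`. -/
theorem hasDerivAt_integral_laplace (μ t₀ : ℝ) :
    HasDerivAt (fun t => ∫ φ in (-π)..π, (Real.cosh (2 * t) - Real.sinh (2 * t) * Real.cos φ) ^ μ)
      (∫ φ in (-π)..π, (2 * Real.sinh (2 * t₀) - 2 * Real.cosh (2 * t₀) * Real.cos φ) * μ *
        (Real.cosh (2 * t₀) - Real.sinh (2 * t₀) * Real.cos φ) ^ (μ - 1)) t₀ :=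
  hasDerivAt_intervalIntegral_of_continuous
    (fun t φ => (Real.cosh (2 * t) - Real.sinh (2 * t) * Real.cos φ) ^ μ)
    (fun t φ => (2 * Real.sinh (2 * t) - 2 * Real.cosh (2 * t) * Real.cos φ) * μ *
      (Real.cosh (2 * t) - Real.sinh (2 * t) * Real.cos φ) ^ (μ - 1))
    (continuous_laplace_rpow μ) (continuous_laplace_rpow_deriv μ)
    (fun t φ => hasDerivAt_laplace_rpow μ t φ) t₀

/-- **The second derivative of Laplace's integral**: the derivative of the first-derivative
integral `t ↦ ∫ B_t · μ · B^{μ-1} dφ` is `∫ [B_tt · μ · B^{μ-1} + (B_t · μ) · (B_t · (μ-1) · B^{μ-2})] dφ`. -/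
theorem hasDerivAt_integral_laplace_deriv (μ t₀ : ℝ) :
    HasDerivAt (fun t => ∫ φ in (-π)..π,
        (2 * Real.sinh (2 * t) - 2 * Real.cosh (2 * t) * Real.cos φ) * μ *
          (Real.cosh (2 * t) - Real.sinh (2 * t) * Real.cos φ) ^ (μ - 1))
      (∫ φ in (-π)..π,
        (4 * Real.cosh (2 * t₀) - 4 * Real.sinh (2 * t₀) * Real.cos φ) * μ *
            (Real.cosh (2 * t₀) - Real.sinh (2 * t₀) * Real.cos φ) ^ (μ - 1) +
          (2 * Real.sinh (2 * t₀) - 2 * Real.cosh (2 * t₀) * Real.cos φ) * μ *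
            ((2 * Real.sinh (2 * t₀) - 2 * Real.cosh (2 * t₀) * Real.cos φ) * (μ - 1) *
              (Real.cosh (2 * t₀) - Real.sinh (2 * t₀) * Real.cos φ) ^ (μ - 1 - 1))) t₀ :=
  hasDerivAt_intervalIntegral_of_continuous
    (fun t φ => (2 * Real.sinh (2 * t) - 2 * Real.cosh (2 * t) * Real.cos φ) * μ *
      (Real.cosh (2 * t) - Real.sinh (2 * t) * Real.cos φ) ^ (μ - 1))
    (fun t φ => (4 * Real.cosh (2 * t) - 4 * Real.sinh (2 * t) * Real.cos φ) * μ *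
        (Real.cosh (2 * t) - Real.sinh (2 * t) * Real.cos φ) ^ (μ - 1) +
      (2 * Real.sinh (2 * t) - 2 * Real.cosh (2 * t) * Real.cos φ) * μ *
        ((2 * Real.sinh (2 * t) - 2 * Real.cosh (2 * t) * Real.cos φ) * (μ - 1) *
          (Real.cosh (2 * t) - Real.sinh (2 * t) * Real.cos φ) ^ (μ - 1 - 1)))
    (continuous_laplace_rpow_deriv μ) (continuous_laplace_rpow_deriv2 μ)
    (fun t φ => hasDerivAt_laplace_rpow_deriv μ t φ) t₀

/-- The first-derivative integrand at `t = 0` is `λ cos φ`. -/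
lemma laplace_deriv_integrand_zero (lam φ : ℝ) :
    (2 * Real.sinh (2 * 0) - 2 * Real.cosh (2 * 0) * Real.cos φ) * (-lam / 2) *
      (Real.cosh (2 * 0) - Real.sinh (2 * 0) * Real.cos φ) ^ (-lam / 2 - 1) = lam * Real.cos φ := by
  simp only [mul_zero, Real.sinh_zero, Real.cosh_zero, zero_mul, sub_zero, zero_sub,
    Real.one_rpow, mul_one]
  ring

/-- `∫_{-π}^{π} λ cos φ dφ = 0`. -/
lemma integral_const_mul_cos (lam : ℝ) : ∫ φ in (-π)..π, lam * Real.cos φ = 0 := by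
  rw [intervalIntegral.integral_const_mul, integral_cos, Real.sin_pi, Real.sin_neg, Real.sin_pi]
  ring

section measure

variable [MeasurableSpace Circle] [BorelSpace Circle]

/-- **The first derivative of `t ↦ sph λ (a_t)`**:
`∂_t sph λ (a_t) = (2π)⁻¹ ∫_{-π}^{π} B_t · (-λ/2) · B^{-λ/2-1} dφ`. -/
theorem hasDerivAt_sph_hyp (lam t₀ : ℝ) :
    HasDerivAt (fun t => sph lam (hyp t))
      ((2 * π)⁻¹ * ∫ φ in (-π)..π,
        (2 * Real.sinh (2 * t₀) - 2 * Real.cosh (2 * t₀) * Real.cos φ) * (-lam / 2) *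
          (Real.cosh (2 * t₀) - Real.sinh (2 * t₀) * Real.cos φ) ^ (-lam / 2 - 1)) t₀ := by
  have e : (fun t => sph lam (hyp t)) = fun t => (2 * π)⁻¹ * ∫ φ in (-π)..π,
      (Real.cosh (2 * t) - Real.sinh (2 * t) * Real.cos φ) ^ (-lam / 2) := by
    funext t
    exact sph_hyp_eq_laplace lam t
  rw [e]
  exact (hasDerivAt_integral_laplace (-lam / 2) t₀).const_mul _

/-- `t ↦ sph λ (a_t)` is differentiable on `ℝ`. -/
theorem differentiable_sph_hyp (lam : ℝ) : Differentiable ℝ fun t => sph lam (hyp t) :=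
  fun t => (hasDerivAt_sph_hyp lam t).differentiableAt

/-- **The derivative of `t ↦ sph λ (a_t)` in closed form.** -/
theorem deriv_sph_hyp (lam t₀ : ℝ) :
    deriv (fun t => sph lam (hyp t)) t₀ =
      (2 * π)⁻¹ * ∫ φ in (-π)..π,
        (2 * Real.sinh (2 * t₀) - 2 * Real.cosh (2 * t₀) * Real.cos φ) * (-lam / 2) *
          (Real.cosh (2 * t₀) - Real.sinh (2 * t₀) * Real.cos φ) ^ (-lam / 2 - 1) :=
  (hasDerivAt_sph_hyp lam t₀).deriv

/-- **The derivative vanishes at `t = 0`**: `∂_t sph λ (a_t) |_{t=0} = 0`. -/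
theorem deriv_sph_hyp_zero (lam : ℝ) : deriv (fun t => sph lam (hyp t)) 0 = 0 := by
  rw [deriv_sph_hyp]
  simp_rw [laplace_deriv_integrand_zero]
  rw [integral_const_mul_cos, mul_zero]

end measure

end Summit.Ventures.HodgeRepro2.T5SU11SphericalDeriv
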